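import Literature.NumberTheory.EllipticCurves.IsogenyXRationalFunctionProofs
import Literature.NumberTheory.EllipticCurves.RegulatorProofs
import Literature.NumberTheory.EllipticCurves.IsogenyMordellWeilRankProofs
import Literature.NumberTheory.EllipticCurves.IsogenyHomProofs
import Literature.NumberTheory.EllipticCurves.GaloisActionProofs
import Mathlib.NumberTheory.Height.MvPolynomial
import Mathlib.Algebra.Polynomial.Eval.Degree
import HarnessLib

/-!
# The canonical height under isogenies: `ĥ_{E'}(φ P) = deg φ · ĥ_E(P)` and
# `⟨φ P, Q⟩_{E'} = ⟨P, φ̂ Q⟩_E`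

Topic `NumberTheory/EllipticCurves`. A *proofs* file (theorems only) establishing, for a
`K`-isogeny `φ : E → E'` of elliptic curves over a number field `K` with dual `φ̂`
(`φ̂ ∘ φ = [deg φ]`, the tree's `Isogeny.exists_dual_of_isElliptic`) and the induced maps
`f = φ(K)`, `g = φ̂(K)` on rational points (`Isogeny.exists_pointHom`):

* `WeierstrassCurve.Isogeny.canonicalHeight_pointHom_eq` — **`ĥ_{E'}(φ P) = deg φ · ĥ_E(P)`**;
* `WeierstrassCurve.Isogeny.heightPairing_pointHom_pointHom` — `⟨φ P, φ Q⟩_{E'} = deg φ · ⟨P, Q⟩_E`;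
* `WeierstrassCurve.Isogeny.heightPairing_pointHom_left` — **`⟨φ P, Q⟩_{E'} = ⟨P, φ̂ Q⟩_E`**, "the
  functoriality of the height pairings" in Milne's proof of the isogeny invariance of the
  Birch–Swinnerton-Dyer conjecture (*ADT*, Thm. I.7.3, p. 97) — hypothesis (H) of
  `WeierstrassCurve.Isogeny.card_sha_mul_regulator_mul_eq_of_keyIdentity`
  (`BSDQuadraticDescentCasselsProofs`).

## The proof (Silverman, *AEC*, VIII.5.6, VIII.9; only upper bounds are needed)

* `Literature.NumberTheory.EllipticCurves.exists_logHeight₁_div_le`: `h(a(t)/b(t)) ≤ d·h(t) + C`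
  for `deg a, deg b ≤ d` — the easy half of Weil's `h ∘ r = deg r · h + O(1)` on `ℙ¹`, from
  Mathlib's `Height.logHeight_eval_le` applied to the binary forms of `a`, `b`.
* `Isogeny.exists_naiveHeight_map_le`: with the `x`-coordinate of `φ` written as
  `a(x)/b(x)`, `a, b ∈ K[X]` of degree `≤ deg φ` (`Isogeny.exists_xy_apply_eq_eval_map_div`,
  file `IsogenyXRationalFunctionProofs`), `h(φ P) ≤ deg φ · h(P) + C` off a finite set of `E(K)`.
* `canonicalHeight_map_le_of_naiveHeight_le` (Tate's limit along `2ⁿ P`):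
  `ĥ(φ P) ≤ deg φ · ĥ(P)` for all `P` (`Isogeny.canonicalHeight_pointHom_le`).
* `Isogeny.card_ker_mul_card_ker_eq_sq`, `Isogeny.degree_eq_of_comp_eq_degree_smul`: the dual
  has the same degree (`#ker φ · #ker φ̂ = #E[m] = m²`, the tree's `card_torsionBy_eq_sq`).
* `canonicalHeight_map_eq_of_le` (the squeeze `m² ĥ(P) = ĥ(φ̂ φ P) ≤ m ĥ(φ P) ≤ m² ĥ(P)`),
  `heightPairing_map_map_eq` (polarisation) and `heightPairing_map_left_eq`
  (`m ⟨φ P, Q⟩ = ⟨φ P, φ φ̂ Q⟩ = m ⟨P, φ̂ Q⟩`).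

No lower bound for heights under rational maps (and so no resultant / Nullstellensatz) is used.

## References

* [SilvermanAEC2009] J. H. Silverman, *The Arithmetic of Elliptic Curves*, 2nd ed. (2009),
  Thm. VIII.5.6, VIII.9 (Prop. VIII.9.1, Thm. VIII.9.3), Thm. III.6.2(e), Cor. III.6.4(b).
* [MilneADT2006] J. S. Milne, *Arithmetic Duality Theorems*, 2nd ed. (2006), Ch. I, proof of
  Thm. 7.3, p. 97 ("The functoriality of the height pairings shows that
  `⟨f^t(b'ⱼ), aᵢ⟩ = ⟨b'ⱼ, f(aᵢ)⟩`").

## Design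

Theorems only; `noncomputable section`, `open scoped Classical`; the maps on rational points
enter as data `f`, `g` with their characterising compatibility with `E(K) ↪ E(K̄)`
(`WeierstrassCurve.toGeomPoints`), as in `IsogenyMordellWeilRankProofs`.
-/

noncomputable section

open scoped Classical

open Polynomial Height

universe u

namespace Literature.NumberTheory.EllipticCurves

section RationalFunctionHeight

variable {K : Type*} [Field K]

/-- The binary form `∑_{i ≤ d} aᵢ X₀^i X₁^{d-i}` attached to `a = ∑ aᵢ Xⁱ` with `deg a ≤ d`
evaluates at `(t, 1)` to `a(t)`. [folklore] -/
theorem eval_sum_monomial_homogenize (a : K[X]) {d : ℕ} (ha : a.natDegree ≤ d) (t : K) :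
    MvPolynomial.eval ![t, 1]
        (∑ i ∈ Finset.range (d + 1), MvPolynomial.C (a.coeff i) * MvPolynomial.X 0 ^ i *
          MvPolynomial.X 1 ^ (d - i) : MvPolynomial (Fin 2) K) = a.eval t := by
  simp only [map_sum, map_mul, map_pow, MvPolynomial.eval_C, MvPolynomial.eval_X,
    Matrix.cons_val_zero, Matrix.cons_val_one, one_pow, mul_one]
  rw [Polynomial.eval_eq_sum_range' (Nat.lt_succ_of_le ha)]

/-- The binary form `∑_{i ≤ d} aᵢ X₀^i X₁^{d-i}` is homogeneous of degree `d`. [folklore] -/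
theorem isHomogeneous_sum_monomial_homogenize (a : K[X]) (d : ℕ) :
    (∑ i ∈ Finset.range (d + 1), MvPolynomial.C (a.coeff i) * MvPolynomial.X 0 ^ i *
          MvPolynomial.X 1 ^ (d - i) : MvPolynomial (Fin 2) K).IsHomogeneous d := by
  refine MvPolynomial.IsHomogeneous.sum _ _ _ fun i hi ↦ ?_
  have hid : i ≤ d := Nat.lt_succ_iff.mp (Finset.mem_range.mp hi)
  have h := ((MvPolynomial.isHomogeneous_C (Fin 2) (a.coeff i)).mul
    ((MvPolynomial.isHomogeneous_X K (0 : Fin 2)).pow i)).mul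
    ((MvPolynomial.isHomogeneous_X K (1 : Fin 2)).pow (d - i))
  simpa [Nat.add_sub_cancel' hid] using h

/-- **Weil's height bound for a rational function on `ℙ¹` (upper half).** For polynomials
`a, b ∈ K[X]` of degree `≤ d` over a field with an admissible family of absolute values there is a
constant `C` with `h(a(t)/b(t)) ≤ d · h(t) + C` for all `t ∈ K` (`h = logHeight₁`): the easy half
of `h(r(t)) = deg r · h(t) + O(1)` (Silverman, *AEC*, Thm. VIII.5.6 for the morphism
`[a : b] : ℙ¹ → ℙ¹`; Hindry–Silverman B.2.5), from Mathlib's `Height.logHeight_eval_le` applied to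
the binary forms of `a` and `b`. (Where `b(t) = 0` the left-hand side is `h(0) = 0` or `h([a(t) : 0])
= 0`, Mathlib's conventions, and the bound holds trivially.) [cite: SilvermanAEC2009, Thm. VIII.5.6] -/
theorem exists_logHeight₁_div_le [AdmissibleAbsValues K] (a b : K[X]) {d : ℕ} (ha : a.natDegree ≤ d) (hb : b.natDegree ≤ d) :
    ∃ C : ℝ, ∀ t : K, logHeight₁ (a.eval t / b.eval t) ≤ d * logHeight₁ t + C := by
  let A : MvPolynomial (Fin 2) K := ∑ i ∈ Finset.range (d + 1),
    MvPolynomial.C (a.coeff i) * MvPolynomial.X 0 ^ i * MvPolynomial.X 1 ^ (d - i)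
  let B : MvPolynomial (Fin 2) K := ∑ i ∈ Finset.range (d + 1),
    MvPolynomial.C (b.coeff i) * MvPolynomial.X 0 ^ i * MvPolynomial.X 1 ^ (d - i)
  let p : Fin 2 → MvPolynomial (Fin 2) K := ![A, B]
  have hp : ∀ j, (p j).IsHomogeneous d := fun j ↦ by
    fin_cases j
    · exact isHomogeneous_sum_monomial_homogenize a d
    · exact isHomogeneous_sum_monomial_homogenize b d
  obtain ⟨C, hC⟩ := logHeight_eval_le' hp
  refine ⟨C, fun t ↦ ?_⟩
  have h := hC ![t, 1]
  have hfun : (fun j ↦ (p j).eval ![t, 1]) = ![a.eval t, b.eval t] := by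
    funext j
    fin_cases j
    · exact eval_sum_monomial_homogenize a ha t
    · exact eval_sum_monomial_homogenize b hb t
  rw [hfun, ← logHeight₁_div_eq_logHeight, ← logHeight₁_eq_logHeight] at h
  linarith

end RationalFunctionHeight

end Literature.NumberTheory.EllipticCurves





namespace WeierstrassCurve

open Affine.Point geomPoints Height


variable {K : Type u} [Field K] [NumberField K] {W W' : WeierstrassCurve K}

/-- **Naive heights under an isogeny: `h(φ P) ≤ d · h(P) + C` off a finite set of `E(K)`**, when
the `x`-coordinate of `φ` is `a(x)/b(x)` with `a, b ∈ K[X]` of degree `≤ d` off a finite set of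
`E(K̄)` (as provided by `Isogeny.exists_xy_apply_eq_eval_map_div`): for `P ∈ E(K)` the
`x`-coordinate of `φ(K) P = f P` is `a(x(P))/b(x(P))`, and `exists_logHeight₁_div_le` applies.
Silverman, *AEC*, VIII.5.6 / VIII.6. [folklore] -/
theorem Isogeny.exists_naiveHeight_map_le (φ : Isogeny W W')
    {f : W.toAffine.Point →+ W'.toAffine.Point}
    (hf : ∀ P, W'.toGeomPoints (f P) = φ (W.toGeomPoints P))
    {a b : K[X]} {d : ℕ} (ha : a.natDegree ≤ d) (hb : b.natDegree ≤ d)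
    {S : Set W.geomPoints} (hS : S.Finite)
    (hx : ∀ P ∉ S, P ≠ 0 → φ P ≠ 0 ∧ xy (φ P) 0 =
      (a.map (algebraMap K (AlgebraicClosure K))).eval (xy P 0) /
        (b.map (algebraMap K (AlgebraicClosure K))).eval (xy P 0)) :
    ∃ (T : Set W.toAffine.Point) (C : ℝ), T.Finite ∧
      ∀ P ∉ T, naiveHeight (f P) ≤ d * naiveHeight P + C := by
  obtain ⟨C, hC⟩ := Literature.NumberTheory.EllipticCurves.exists_logHeight₁_div_le a b ha hb
  refine ⟨W.toGeomPoints ⁻¹' S ∪ {0}, C, (hS.preimage (toGeomPoints_injective W).injOn).union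
    (Set.finite_singleton 0), fun P hP ↦ ?_⟩
  simp only [Set.mem_union, Set.mem_preimage, Set.mem_singleton_iff, not_or] at hP
  obtain ⟨hPS, hP0⟩ := hP
  have hg0 : W.toGeomPoints P ≠ 0 := fun h ↦ hP0 (toGeomPoints_injective W (by rw [h, _root_.map_zero]))
  obtain ⟨hφ0, hφx⟩ := hx _ hPS hg0
  rcases P with _ | ⟨x, y, hxy⟩
  · exact (hP0 rfl).elim
  rw [← hf] at hφ0 hφx
  rcases hfP : f (.some x y hxy) with _ | ⟨x', y', hxy'⟩
  · rw [hfP] at hφ0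
    exact (hφ0 rfl).elim
  rw [hfP] at hφx
  change algebraMap K (AlgebraicClosure K) x' =
    (a.map (algebraMap K (AlgebraicClosure K))).eval (algebraMap K (AlgebraicClosure K) x) /
      (b.map (algebraMap K (AlgebraicClosure K))).eval (algebraMap K (AlgebraicClosure K) x) at hφx
  rw [eval_map, eval₂_hom, eval_map, eval₂_hom, ← map_div₀] at hφx
  have hx' : x' = a.eval x / b.eval x := (algebraMap K (AlgebraicClosure K)).injective hφx
  rw [naiveHeight_some, naiveHeight_some, hx']
  exact hC x

end WeierstrassCurve




namespace WeierstrassCurve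

open Affine.Point


variable {K : Type u} [Field K] [NumberField K] {W W' : WeierstrassCurve K} [W.IsElliptic]

/-- **From naive to canonical heights along a homomorphism.** If `f : E(K) → E'(K)` is a
homomorphism with `h(f P) ≤ d · h(P) + C` for all `P` off a finite set (naive heights), then
`ĥ(f P) ≤ d · ĥ(P)` for *all* `P` (canonical heights): for non-torsion `P` apply the bound to
`2ⁿ P`, which leaves the finite set, and use `ĥ(2ⁿ Q) = 4ⁿ ĥ(Q)` and `ĥ = h + O(1)`; torsion `P`
have `ĥ(P) = ĥ(f P) = 0`. Tate's limit argument (Silverman, *AEC*, VIII.9, proof of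
Prop. VIII.9.1 / Thm. VIII.9.3). [folklore] -/
theorem canonicalHeight_map_le_of_naiveHeight_le [W'.IsElliptic]
    (f : W.toAffine.Point →+ W'.toAffine.Point)
    {d : ℕ} {C : ℝ} {S : Set W.toAffine.Point} (hS : S.Finite)
    (h : ∀ P ∉ S, naiveHeight (f P) ≤ d * naiveHeight P + C) (P : W.toAffine.Point) :
    canonicalHeight (f P) ≤ d * canonicalHeight P := by
  by_cases hP : IsOfFinAddOrder P
  · rw [canonicalHeight_of_isOfFinAddOrder_holds (f.isOfFinAddOrder hP),
      canonicalHeight_of_isOfFinAddOrder_holds hP, mul_zero]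
  -- `ĥ = h + O(1)` on both curves gives `ĥ(f Q) ≤ d ĥ(Q) + C₃` off `S`
  obtain ⟨C₁, hC₁⟩ := exists_abs_canonicalHeight_sub_naiveHeight_le_holds (W := W)
  obtain ⟨C₂, hC₂⟩ := exists_abs_canonicalHeight_sub_naiveHeight_le_holds (W := W')
  have hd : (0 : ℝ) ≤ d := Nat.cast_nonneg d
  have hoff : ∀ Q ∉ S, canonicalHeight (f Q) ≤ d * canonicalHeight Q + (C₂ + d * C₁ + C) := by
    intro Q hQ
    have h₁ := abs_le.mp (hC₁ Q)
    have h₂ := abs_le.mp (hC₂ (f Q))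
    have h₃ := h Q hQ
    nlinarith
  -- `n ↦ 2ⁿ P` is injective, so `2ⁿ P ∉ S` for all large `n`
  have hinj : Function.Injective fun n : ℕ ↦ (2 ^ n) • P := by
    intro n₁ n₂ h12
    by_contra hne
    simp only at h12
    rcases Nat.lt_or_gt_of_ne hne with hlt | hlt
    · apply hP
      rw [isOfFinAddOrder_iff_nsmul_eq_zero]
      refine ⟨2 ^ n₂ - 2 ^ n₁, Nat.sub_pos_of_lt (Nat.pow_lt_pow_right (by norm_num) hlt), ?_⟩
      rw [sub_nsmul _ (Nat.pow_le_pow_right (by norm_num) hlt.le), ← h12, add_neg_cancel]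
    · apply hP
      rw [isOfFinAddOrder_iff_nsmul_eq_zero]
      refine ⟨2 ^ n₁ - 2 ^ n₂, Nat.sub_pos_of_lt (Nat.pow_lt_pow_right (by norm_num) hlt), ?_⟩
      rw [sub_nsmul _ (Nat.pow_le_pow_right (by norm_num) hlt.le), h12, add_neg_cancel]
  have hfinN : {n : ℕ | (2 ^ n) • P ∈ S}.Finite := hS.preimage hinj.injOn
  obtain ⟨N, hN⟩ := hfinN.bddAbove
  have hlarge : ∀ n, N < n → (2 ^ n) • P ∉ S := fun n hn hmem ↦ (hN hmem).not_gt hn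
  -- the bound at `2ⁿ P`: `4ⁿ ĥ(f P) ≤ 4ⁿ d ĥ(P) + C₃`
  have key : ∀ n, N < n → (4 : ℝ) ^ n * canonicalHeight (f P) ≤
      (4 : ℝ) ^ n * (d * canonicalHeight P) + (C₂ + d * C₁ + C) := by
    intro n hn
    have h1 := hoff _ (hlarge n hn)
    rw [map_nsmul, canonicalHeight_nsmul_holds, canonicalHeight_nsmul_holds] at h1
    push_cast at h1
    have h4 : ((2 : ℝ) ^ n) ^ 2 = 4 ^ n := by
      rw [← pow_mul, mul_comm, pow_mul]; norm_num
    rw [h4] at h1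
    linarith
  -- let `n → ∞`
  by_contra hlt
  push Not at hlt
  set ε := canonicalHeight (f P) - d * canonicalHeight P with hε
  have hεpos : 0 < ε := by linarith
  -- choose `n > N` with `4ⁿ ε > C₃`
  obtain ⟨n, hn⟩ := pow_unbounded_of_one_lt ((C₂ + d * C₁ + C) / ε) (by norm_num : (1 : ℝ) < 4)
  have hn' : (C₂ + d * C₁ + C) / ε < 4 ^ (max n (N + 1)) :=
    hn.trans_le (pow_le_pow_right₀ (by norm_num) (le_max_left _ _))
  have hk := key (max n (N + 1)) (Nat.lt_of_lt_of_le (Nat.lt_succ_self N) (le_max_right _ _))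
  rw [div_lt_iff₀ hεpos] at hn'
  have : (4 : ℝ) ^ (max n (N + 1)) * ε ≤ C₂ + d * C₁ + C := by
    rw [hε, mul_sub]; linarith
  linarith

/-- **The squeeze for an isogeny and its dual.** If `g ∘ f = [m]` on `E(K)` with `m ≠ 0` and
`ĥ(f P) ≤ m ĥ(P)`, `ĥ(g Q) ≤ m ĥ(Q)` for all `P ∈ E(K)`, `Q ∈ E'(K)`, then `ĥ(f P) = m ĥ(P)`:
`m² ĥ(P) = ĥ(g (f P)) ≤ m ĥ(f P) ≤ m² ĥ(P)`. This is `ĥ_{E'}(φ P) = deg φ · ĥ_E(P)` for an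
isogeny `φ` of degree `m` and its dual (Silverman, *AEC*, VIII.9, cf. Thm. VIII.9.3(b) for
`φ = [m]`). [folklore] -/
theorem canonicalHeight_map_eq_of_le (f : W.toAffine.Point →+ W'.toAffine.Point)
    (g : W'.toAffine.Point →+ W.toAffine.Point) {m : ℕ} (hm : m ≠ 0)
    (hgf : ∀ P, g (f P) = m • P)
    (hf : ∀ P, canonicalHeight (f P) ≤ m * canonicalHeight P)
    (hg : ∀ Q, canonicalHeight (g Q) ≤ m * canonicalHeight Q) (P : W.toAffine.Point) :
    canonicalHeight (f P) = m * canonicalHeight P := by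
  have h1 := hg (f P)
  rw [hgf, canonicalHeight_nsmul_holds] at h1
  have h2 := hf P
  have hm' : (0 : ℝ) < m := by exact_mod_cast Nat.pos_of_ne_zero hm
  nlinarith

/-- **Isogenies scale the height pairing by the degree**: under the hypotheses of
`canonicalHeight_map_eq_of_le`, `⟨f P, f Q⟩_{E'} = m ⟨P, Q⟩_E` (polarisation of
`ĥ(f P) = m ĥ(P)`). Silverman, *AEC*, VIII.9. [folklore] -/
theorem heightPairing_map_map_eq (f : W.toAffine.Point →+ W'.toAffine.Point)
    (g : W'.toAffine.Point →+ W.toAffine.Point) {m : ℕ} (hm : m ≠ 0)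
    (hgf : ∀ P, g (f P) = m • P)
    (hf : ∀ P, canonicalHeight (f P) ≤ m * canonicalHeight P)
    (hg : ∀ Q, canonicalHeight (g Q) ≤ m * canonicalHeight Q) (P Q : W.toAffine.Point) :
    heightPairing (f P) (f Q) = m * heightPairing P Q := by
  unfold heightPairing
  rw [← map_add, canonicalHeight_map_eq_of_le f g hm hgf hf hg,
    canonicalHeight_map_eq_of_le f g hm hgf hf hg, canonicalHeight_map_eq_of_le f g hm hgf hf hg]
  ring

/-- **Adjointness of an isogeny and its dual for the Néron–Tate pairing** ("the functoriality
of the height pairings" of Milne, *ADT*, proof of Thm. I.7.3, p. 97; Silverman, *AEC*, VIII.9):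
if `g ∘ f = [m]` on `E(K)`, `f ∘ g = [m]` on `E'(K)`, `m ≠ 0`, and `ĥ(f P) ≤ m ĥ(P)`,
`ĥ(g Q) ≤ m ĥ(Q)`, then `⟨f P, Q⟩_{E'} = ⟨P, g Q⟩_E`:
`m ⟨f P, Q⟩ = ⟨f P, f (g Q)⟩ = m ⟨P, g Q⟩`. [cite: MilneADT2006, Ch. I, proof of Thm. 7.3, p. 97] -/
theorem heightPairing_map_left_eq [W'.IsElliptic] (f : W.toAffine.Point →+ W'.toAffine.Point)
    (g : W'.toAffine.Point →+ W.toAffine.Point) {m : ℕ} (hm : m ≠ 0)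
    (hgf : ∀ P, g (f P) = m • P) (hfg : ∀ Q, f (g Q) = m • Q)
    (hf : ∀ P, canonicalHeight (f P) ≤ m * canonicalHeight P)
    (hg : ∀ Q, canonicalHeight (g Q) ≤ m * canonicalHeight Q)
    (P : W.toAffine.Point) (Q : W'.toAffine.Point) :
    heightPairing (f P) Q = heightPairing P (g Q) := by
  have hm' : (m : ℝ) ≠ 0 := by exact_mod_cast hm
  have h := heightPairing_map_map_eq f g hm hgf hf hg P (g Q)
  rw [hfg, ← natCast_zsmul, heightPairing_zsmul_right, Int.cast_natCast] at h
  exact mul_left_cancel₀ hm' h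

end WeierstrassCurve

namespace WeierstrassCurve

namespace Isogeny

open Literature.NumberTheory.EllipticCurves Affine.Point geomPoints

variable {K : Type u} [Field K] {W W' : WeierstrassCurve K} [W.IsElliptic] [W'.IsElliptic]

/-- **`#ker φ · #ker ψ = m²` when `ψ ∘ φ = [m]`** (`m ≠ 0` in `K`): `φ` maps `E[m] = ker(ψ ∘ φ)`
onto `ker ψ` (isogenies are onto `K̄`-points) with kernel `ker φ`, and `#E[m] = m²` (Silverman,
*AEC*, Cor. III.6.4(b), the tree's `card_torsionBy_eq_sq`). In particular the dual of an isogeny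
of degree `m` has degree `m` (*AEC* Thm. III.6.2(e)). [cite: SilvermanAEC2009, Thm. III.6.2(e)] -/
theorem card_ker_mul_card_ker_eq_sq (φ : Isogeny W W') (ψ : Isogeny W' W) {m : ℕ}
    (hm : (m : K) ≠ 0) (h : ∀ P : W.geomPoints, ψ (φ P) = (m : ℤ) • P) :
    Nat.card φ.toAddMonoidHom.ker * Nat.card ψ.toAddMonoidHom.ker = m ^ 2 := by
  set T : AddSubgroup W.geomPoints := AddSubgroup.torsionBy W.geomPoints (m : ℤ) with hT
  -- `φ` restricted to `E[m]`, with values in `ker ψ`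
  have hmapsto : ∀ P : T, φ (P : W.geomPoints) ∈ ψ.toAddMonoidHom.ker := fun P ↦ by
    rw [AddMonoidHom.mem_ker, coe_toAddMonoidHom, h]
    exact AddSubgroup.torsionBy.nsmul_iff.mp P.2
  set fT : T →+ ψ.toAddMonoidHom.ker :=
    (φ.toAddMonoidHom.comp T.subtype).codRestrict ψ.toAddMonoidHom.ker hmapsto with hfT
  have hsurj : Function.Surjective fT := by
    rintro ⟨Q, hQ⟩
    obtain ⟨P, rfl⟩ := φ.surjective Q
    have hPT : P ∈ T := by
      rw [hT, AddSubgroup.torsionBy.nsmul_iff, ← natCast_zsmul, ← h]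
      exact (AddMonoidHom.mem_ker.mp hQ)
    exact ⟨⟨P, hPT⟩, rfl⟩
  have hker : Nat.card fT.ker = Nat.card φ.toAddMonoidHom.ker := by
    refine Nat.card_congr
      { toFun := fun P ↦ ⟨(P.1 : W.geomPoints), ?_⟩
        invFun := fun P ↦ ⟨⟨P.1, ?_⟩, ?_⟩
        left_inv := fun P ↦ by ext; rfl
        right_inv := fun P ↦ by ext; rfl }
    · have hP := P.2
      rw [AddMonoidHom.mem_ker] at hP ⊢
      exact congrArg Subtype.val hP
    · rw [hT, AddSubgroup.torsionBy.nsmul_iff, ← natCast_zsmul, ← h]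
      have hP : φ (P : W.geomPoints) = 0 := (AddMonoidHom.mem_ker).mp P.2
      rw [hP, _root_.map_zero]
    · rw [AddMonoidHom.mem_ker]
      exact Subtype.ext ((AddMonoidHom.mem_ker).mp P.2)
  -- `#E[m] = m²`
  have hTcard : Nat.card T = m ^ 2 := by
    have hm' : (m : AlgebraicClosure K) ≠ 0 := by
      rw [show (m : AlgebraicClosure K) = algebraMap K (AlgebraicClosure K) m from
        (map_natCast _ m).symm]
      exact (map_ne_zero_iff _ (algebraMap K (AlgebraicClosure K)).injective).mpr hm
    exact card_torsionBy_eq_sq (E := W.baseChange (AlgebraicClosure K)) hm'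
  rw [← hTcard, ← hker, AddSubgroup.card_eq_card_quotient_mul_card_addSubgroup fT.ker,
    Nat.card_congr (QuotientAddGroup.quotientKerEquivRange fT).toEquiv,
    AddMonoidHom.range_eq_top.mpr hsurj, AddSubgroup.card_top, mul_comm]

/-- **The dual isogeny has the same degree**: if `ψ ∘ φ = [deg φ]` (the dual isogeny of
`Isogeny.exists_dual_of_isElliptic`, characteristic `0`) then `#ker ψ = #ker φ`.
Silverman, *AEC*, Thm. III.6.2(e). [cite: SilvermanAEC2009, Thm. III.6.2(e)] -/
theorem degree_eq_of_comp_eq_degree_smul [CharZero K] (φ : Isogeny W W') (ψ : Isogeny W' W)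
    (h : ∀ P : W.geomPoints, ψ (φ P) = (φ.degree : ℤ) • P) : ψ.degree = φ.degree := by
  have hm : (φ.degree : K) ≠ 0 := by exact_mod_cast φ.degree_pos.ne'
  have key := card_ker_mul_card_ker_eq_sq φ ψ hm h
  rw [← Isogeny.degree, ← Isogeny.degree, sq] at key
  exact (Nat.eq_of_mul_eq_mul_left φ.degree_pos key).symm |>.symm

variable [NumberField K]

/-- **The canonical height under an isogeny: `ĥ_{E'}(φ P) ≤ deg φ · ĥ_E(P)`** for `P ∈ E(K)`
(`φ` a `K`-isogeny of elliptic curves over a number field, `φ(K) = f` on rational points,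
`deg φ = #ker φ`). From the `x`-coordinate of `φ` as a `K`-rational function of degree `deg φ`
(`exists_xy_apply_eq_eval_map_div`), Weil's upper bound `h(r(t)) ≤ deg r · h(t) + O(1)`
(`exists_logHeight₁_div_le`) and Tate's limit (`canonicalHeight_map_le_of_naiveHeight_le`).
Silverman, *AEC*, VIII.5.6 with VIII.9.3. [folklore] -/
theorem canonicalHeight_pointHom_le (φ : Isogeny W W') {f : W.toAffine.Point →+ W'.toAffine.Point}
    (hf : ∀ P, W'.toGeomPoints (f P) = φ (W.toGeomPoints P)) (P : W.toAffine.Point) :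
    canonicalHeight (f P) ≤ φ.degree * canonicalHeight P := by
  obtain ⟨a, b, S, hS, -, hdeg, h⟩ := φ.exists_xy_apply_eq_eval_map_div
  have ha : a.natDegree ≤ φ.degree := hdeg ▸ le_max_left _ _
  have hb : b.natDegree ≤ φ.degree := hdeg ▸ le_max_right _ _
  obtain ⟨T, C, hT, hTC⟩ := φ.exists_naiveHeight_map_le hf ha hb hS fun P hP hP0 ↦
    ⟨(h P hP hP0).1, (h P hP hP0).2.2⟩
  exact canonicalHeight_map_le_of_naiveHeight_le f hT hTC P

/-- **Functoriality of the canonical height: `ĥ_{E'}(φ P) = deg φ · ĥ_E(P)`** for a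
`K`-isogeny `φ : E → E'` of elliptic curves over a number field and `P ∈ E(K)` (`f = φ(K)`).
The upper bounds for `φ` and for its dual `φ̂` (`φ̂ ∘ φ = [m]`, `m = deg φ = deg φ̂`) squeeze:
`m² ĥ(P) = ĥ(φ̂ φ P) ≤ m ĥ(φ P) ≤ m² ĥ(P)`. Silverman, *AEC*, VIII.9 (Thm. VIII.9.3(b) is the
case `φ = [m]`); Milne, *ADT*, proof of Thm. I.7.3 ("functoriality of the height pairings").
[folklore] -/
theorem canonicalHeight_pointHom_eq (φ : Isogeny W W') {f : W.toAffine.Point →+ W'.toAffine.Point}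
    (hf : ∀ P, W'.toGeomPoints (f P) = φ (W.toGeomPoints P)) (P : W.toAffine.Point) :
    canonicalHeight (f P) = φ.degree * canonicalHeight P := by
  obtain ⟨ψ, hψ⟩ := φ.exists_dual_of_isElliptic
  obtain ⟨g, hg⟩ := ψ.exists_pointHom
  have hgf : ∀ P, g (f P) = φ.degree • P := fun P ↦ by
    apply toGeomPoints_injective W
    rw [hg, hf, hψ, ← natCast_zsmul, map_zsmul]
  have hψdeg := degree_eq_of_comp_eq_degree_smul φ ψ hψ
  refine canonicalHeight_map_eq_of_le f g φ.degree_pos.ne' hgf (canonicalHeight_pointHom_le φ hf)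
    (fun Q ↦ ?_) P
  rw [← hψdeg]
  exact canonicalHeight_pointHom_le ψ hg Q

/-- **`⟨φ P, φ Q⟩_{E'} = deg φ · ⟨P, Q⟩_E`** for the Néron–Tate pairings (polarisation of
`canonicalHeight_pointHom_eq`). Silverman, *AEC*, VIII.9. [folklore] -/
theorem heightPairing_pointHom_pointHom (φ : Isogeny W W')
    {f : W.toAffine.Point →+ W'.toAffine.Point}
    (hf : ∀ P, W'.toGeomPoints (f P) = φ (W.toGeomPoints P)) (P Q : W.toAffine.Point) :
    heightPairing (f P) (f Q) = φ.degree * heightPairing P Q := by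
  unfold heightPairing
  rw [← map_add, canonicalHeight_pointHom_eq φ hf, canonicalHeight_pointHom_eq φ hf,
    canonicalHeight_pointHom_eq φ hf]
  ring

/-- **An isogeny and its dual are adjoint for the Néron–Tate pairings:
`⟨φ P, Q⟩_{E'} = ⟨P, φ̂ Q⟩_E`** for `P ∈ E(K)`, `Q ∈ E'(K)`, where `φ̂ ∘ φ = [deg φ]`
(`f = φ(K)`, `g = φ̂(K)` the maps on rational points). This is "the functoriality of the height
pairings" `⟨f^t(b'), a⟩ = ⟨b', f(a)⟩` of Milne, *ADT*, proof of Thm. I.7.3 (p. 97), for elliptic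
curves (`E ≅ E^t`, `f^t = φ̂`); hypothesis (H) of
`WeierstrassCurve.Isogeny.card_sha_mul_regulator_mul_eq_of_keyIdentity`.
[cite: MilneADT2006, Ch. I, proof of Thm. 7.3, p. 97] -/
theorem heightPairing_pointHom_left (φ : Isogeny W W') (ψ : Isogeny W' W)
    (hψφ : ∀ P : W.geomPoints, ψ (φ P) = (φ.degree : ℤ) • P)
    {f : W.toAffine.Point →+ W'.toAffine.Point}
    (hf : ∀ P, W'.toGeomPoints (f P) = φ (W.toGeomPoints P))
    {g : W'.toAffine.Point →+ W.toAffine.Point}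
    (hg : ∀ Q, W.toGeomPoints (g Q) = ψ (W'.toGeomPoints Q))
    (P : W.toAffine.Point) (Q : W'.toAffine.Point) :
    heightPairing (f P) Q = heightPairing P (g Q) := by
  have hgf : ∀ P, g (f P) = φ.degree • P := fun P ↦ by
    apply toGeomPoints_injective W
    rw [hg, hf, hψφ, ← natCast_zsmul, map_zsmul]
  have hφψ : ∀ Q : W'.geomPoints, φ (ψ Q) = (φ.degree : ℤ) • Q := fun Q ↦ by
    obtain ⟨P, rfl⟩ := φ.surjective Q
    rw [hψφ, map_zsmul]
  have hfg : ∀ Q, f (g Q) = φ.degree • Q := fun Q ↦ by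
    apply toGeomPoints_injective W'
    rw [hf, hg, hφψ, ← natCast_zsmul, map_zsmul]
  have hψdeg := degree_eq_of_comp_eq_degree_smul φ ψ hψφ
  refine heightPairing_map_left_eq f g φ.degree_pos.ne' hgf hfg (canonicalHeight_pointHom_le φ hf)
    (fun R ↦ ?_) P Q
  rw [← hψdeg]
  exact canonicalHeight_pointHom_le ψ hg R

end Isogeny

end WeierstrassCurve

end
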